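import Literature.AlgebraicGeometry.Resolution.Lipman1969ConverseBaseChange
import Literature.AlgebraicGeometry.Resolution.Lipman1969DominationByQuadraticTransforms
import HarnessLib

/-!
# Lipman 1969, Proposition (16.5) from statement B) of the proof of Proposition (1.2)
# (instead of Proposition (1.2) itself)

Topic: `Literature/AlgebraicGeometry/Resolution`.  PROVED, fact-free rewiring.  The tree derives the named fact
`Lipman1969_16_5` (J. Lipman, Publ. Math. IHÉS 36 (1969), Prop. (16.5), p. 235: normality and rationality
ascend and descend along `A → B` flat local with `𝔪_A B = 𝔪_B` and separable residue extension) from the named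
fact `Lipman1969_1_2` (`Lipman1969ConverseBaseChange.Lipman1969_16_5_of_1_2`), using Prop. (1.2) only through
«every desingularization of a rational singularity has `H¹ = 0`»
(`Lipman1969_1_2.hasTrivialCechH1_of_isResolution`).  That consequence is now a theorem modulo the smaller print
residue B) of Lipman's own proof of (1.2) — `Lipman1969_1_2_B` (= a special case of Theorem (26.1), Zariski's
elimination of indeterminacies), `Lipman1969DominationByQuadraticTransforms` with the fact-free
`Lipman1969H1Domination` — via `Lipman1969_1_2_B.hasTrivialCechH1_of_isResolution`.  This file repeats the last
step of the printed proof of (16.5) (p. 235–236: `g_B` is a desingularization of the rational `B`, so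
`H¹(Y ×_A Spec B, 𝒪) = 0`; faithfully flat descent of `H¹`) with that drop-in replacement:

* `Lipman1969_16_5_rational_mpr_of_B`, `Lipman1969_16_5_rational_iff_of_B`, `Lipman1969_16_5_of_B :
  Lipman1969_1_2_B → Lipman1969_16_5`.

So in the W4.4 facts bundles (`…NoZenoRFactsW3Residual`: `Lipman1969_16_5 ⇐ Lipman1969_1_2`) the conjunct
(16.5) is supplied by B) as well.  Nothing else is claimed; `Lipman1969_1_2` and `Lipman1969_1_2_B` stay PRINT.

## References
* J. Lipman, Publ. Math. IHÉS 36 (1969): Prop. (16.5) (p. 235, proof pp. 235–236); Prop. (1.2) and its proof,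
  statement B) (pp. 199–200); Theorem (26.1) (p. 274). [Lipman1969]
-/

noncomputable section

open CategoryTheory AlgebraicGeometry TopologicalSpace IsLocalRing
open Literature.AlgebraicGeometry.Morphisms

universe u

namespace Literature.AlgebraicGeometry.Resolution

/-- **Lipman 1969, Proposition (16.5), "`B` rational ⇒ `A` rational"** (for `A` normal), with the binders of
`Lipman1969_16_5` verbatim, CONDITIONAL on statement B) of the proof of Prop. (1.2) (`hB : Lipman1969_1_2_B`)
instead of Prop. (1.2).  Proof as printed (p. 235): `B` is normal (forward half), `g_B : Y ×_A Spec B → Spec B`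
is a desingularization of `B` (Lemma (16.1) (ii), `Lipman1969_16_1_ii_holds`), so `H¹(Y ×_A Spec B, 𝒪) = 0`
(`Lipman1969_1_2_B.hasTrivialCechH1_of_isResolution`), and `H¹` descends along the faithfully flat `A → B`
(`HasTrivialCechH1.of_pullback_snd_of_faithfullyFlat`). [cite: Lipman1969, Proposition (16.5) (p. 235, proof pp. 235–236)] -/
theorem Lipman1969_16_5_rational_mpr_of_B (hB : Lipman1969_1_2_B.{u}) :
    ∀ (A B : Type u) [CommRing A] [CommRing B] [IsNoetherianRing A] [IsNoetherianRing B]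
    [IsLocalRing A] [IsLocalRing B] [Algebra A B] [IsLocalHom (algebraMap A B)] [Module.Flat A B],
    IsReduced A →
    (maximalIdeal A).map (algebraMap A B) = maximalIdeal B →
    Algebra.IsSeparable (ResidueField A) (ResidueField B) →
    ringKrullDim A = 2 → ringKrullDim B = 2 →
    (∃ (Y : Scheme.{u}) (g : Y ⟶ Spec (.of A)), IsResolution g) →
      (IsDomain A ∧ IsIntegrallyClosed A) → HasRationalSingularity B → HasRationalSingularity A := by
  intro A B _ _ _ _ _ _ _ _ _ hred hmax hsep hdA hdB hY hA hBrat
  obtain ⟨Y, g, hg⟩ := hY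
  -- `B` is normal (forward half of the normality clause)
  obtain ⟨hdB', hicB⟩ := Lipman1969_16_5_normal_mp A B hred hmax hsep hdA hdB ⟨Y, g, hg⟩ hA
  haveI := hdB'
  haveI := hicB
  -- `g_B : Y ×_A Spec B → Spec B` is a desingularization of `B` (Lemma (16.1) (ii))
  obtain ⟨-, hres⟩ := Lipman1969_16_1_ii_holds A B hred hmax hsep Y g hg
  -- `H¹(Y ×_A Spec B, 𝒪) = 0` by Proposition (1.2) 2) modulo B) for the rational `B`
  have hZ := Lipman1969_1_2_B.hasTrivialCechH1_of_isResolution hB hdB hBrat _ hres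
  -- faithfully flat descent of `H¹ = 0`
  haveI : IsProper g := hg.isProper
  haveI : Module.FaithfullyFlat A B := Module.FaithfullyFlat.of_flat_of_isLocalHom
  exact ⟨Y, g, hg, HasTrivialCechH1.of_pullback_snd_of_faithfullyFlat g hZ⟩

/-- **Lipman 1969, Proposition (16.5), rationality clause** (IFF, for `A` normal), with the binders of
`Lipman1969_16_5` verbatim, conditional on statement B) for the converse.
[cite: Lipman1969, Proposition (16.5) (p. 235)] -/
theorem Lipman1969_16_5_rational_iff_of_B (hB : Lipman1969_1_2_B.{u}) :
    ∀ (A B : Type u) [CommRing A] [CommRing B] [IsNoetherianRing A] [IsNoetherianRing B]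
    [IsLocalRing A] [IsLocalRing B] [Algebra A B] [IsLocalHom (algebraMap A B)] [Module.Flat A B],
    IsReduced A →
    (maximalIdeal A).map (algebraMap A B) = maximalIdeal B →
    Algebra.IsSeparable (ResidueField A) (ResidueField B) →
    ringKrullDim A = 2 → ringKrullDim B = 2 →
    (∃ (Y : Scheme.{u}) (g : Y ⟶ Spec (.of A)), IsResolution g) →
      (IsDomain A ∧ IsIntegrallyClosed A) →
        (HasRationalSingularity A ↔ HasRationalSingularity B) :=
  fun A B _ _ _ _ _ _ _ _ _ hred hmax hsep hdA hdB hY hA =>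
    ⟨Lipman1969_16_5_rational_mp A B hred hmax hsep hdA hdB hY hA,
      Lipman1969_16_5_rational_mpr_of_B hB A B hred hmax hsep hdA hdB hY hA⟩

/-- **Lipman 1969, Proposition (16.5), from statement B) of the proof of Proposition (1.2)**: the named fact
`Lipman1969_16_5` follows from `Lipman1969_1_2_B` (normality clause unconditional, `Lipman1969_16_5_normal_iff`;
rationality clause `Lipman1969_16_5_rational_iff_of_B`).  Consumers holding `(hB : Lipman1969_1_2_B)` obtain
`Lipman1969_16_5` as `Lipman1969_16_5_of_B hB`. [cite: Lipman1969, Proposition (16.5) (p. 235, proof pp. 235–236)] -/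
theorem Lipman1969_16_5_of_B (hB : Lipman1969_1_2_B.{u}) : Lipman1969_16_5.{u} :=
  fun A B _ _ _ _ _ _ _ _ _ hred hmax hsep hdA hdB hY =>
    ⟨Lipman1969_16_5_normal_iff A B hred hmax hsep hdA hdB hY,
      Lipman1969_16_5_rational_iff_of_B hB A B hred hmax hsep hdA hdB hY⟩

/-- CONSUMER SHAPE CHECK (proved): at universe `0` the conjunct `Lipman1969_16_5.{0}` of the W4.4 facts bundles
is supplied by one token from `Lipman1969_1_2_B.{0}`. -/
example (hB : Lipman1969_1_2_B.{0}) : Lipman1969_16_5.{0} := Lipman1969_16_5_of_B hB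

end Literature.AlgebraicGeometry.Resolution

end
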